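import Literature.NumberTheory.LFunctions.WeilExplicitContinuous
import Literature.NumberTheory.LFunctions.ZetaScrew
import Literature.NumberTheory.LFunctions.FordZetaZeroRecipSqSum
import Literature.Analysis.SpecialFunctions.DigammaLogBound
import Summits.RiemannHypothesis.RiemannHypothesis.Theorems.SoloInformedTentTest
import HarnessLib

/-!
# T46 — The explicit formula for the tent: Suzuki's series equals `W(Δ_t)`

Second step towards the named fact `Suzuki2023_thm11_series`. The tree's explicit formula for
continuous compactly supported test functions (`explicit_formula_continuous`) applies to the tent
`Δ_t` (T45): the zero side converges absolutely because `‖Δ̂_t(ρ)‖ ≤ 2(e^{t/2}+1)/‖ρ‖²` and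
`∑_ρ m(ρ)/‖ρ‖² < ∞` (`FordL33.summable_order_div_norm_sq`); the archimedean integrand is
integrable because `‖Δ̂_t(½+iu)‖ ≤ (t²+4)/(1+u²)` against `‖ψ(¼+iu/2)‖ ≤ C + log(1+|u|)`
(`integrable_logWeight`: `(A + log(1+|u|))/(1+u²) ≤ 2(A+2)(1+|u|)^{-3/2}`). Hence

  `∑_ρ m(ρ) (cosh((ρ−½)t) − 1)/(ρ−½)² = W(Δ_t)`   (`hasSum_screw_weilFunctional_tent`),

with `W(Δ_t) = 4(e^{t/2}+e^{−t/2}−2) − zetaScrewPrimeSum t + weilArchTerm Δ_t`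
(`weilFunctional_tent`). What remains for Suzuki's (1.1) is the archimedean term (T47, T48).
-/

noncomputable section

open scoped Real Topology
open Complex Filter Set MeasureTheory Literature.NumberTheory.LFunctions

namespace Summit.RiemannHypothesis.RiemannHypothesis.Theorems

/-! ## The zero side converges absolutely -/

/-- A non-trivial zero is not `½`. -/
theorem nontrivialZero_ne_half (ρ : ZetaZeros.riemannZetaNontrivialZeros) : (ρ : ℂ) ≠ 1 / 2 := by
  intro h
  have him : (ρ : ℂ).im ≠ 0 := ZetaZeros.riemannZetaNontrivialZeros.im_ne_zero ρ.2
  have := congrArg Complex.im h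
  simp at this
  exact him this

/-- `‖cosh((ρ − ½)t) − 1‖ ≤ e^{t/2} + 1` for `0 < Re ρ < 1`, `t ≥ 0`. -/
theorem norm_cosh_sub_one_le {t : ℝ} (ht : 0 ≤ t) {ρ : ℂ} (h0 : 0 < ρ.re) (h1 : ρ.re < 1) :
    ‖Complex.cosh ((ρ - 1 / 2) * t) - 1‖ ≤ Real.exp (t / 2) + 1 := by
  refine (norm_sub_le _ _).trans ?_
  rw [norm_one]
  gcongr
  have hre : ((ρ - 1 / 2) * (t : ℂ)).re = (ρ.re - 1 / 2) * t := by
    simp [sub_re, mul_re]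
  have hA : ‖cexp ((ρ - 1 / 2) * t)‖ ≤ Real.exp (t / 2) := by
    rw [Complex.norm_exp, hre]
    exact Real.exp_le_exp.2 (by nlinarith)
  have hB : ‖cexp (-((ρ - 1 / 2) * t))‖ ≤ Real.exp (t / 2) := by
    rw [Complex.norm_exp, neg_re, hre]
    exact Real.exp_le_exp.2 (by nlinarith)
  rw [Complex.cosh, norm_div, RCLike.norm_ofNat]
  calc ‖cexp ((ρ - 1 / 2) * t) + cexp (-((ρ - 1 / 2) * t))‖ / 2
      ≤ (‖cexp ((ρ - 1 / 2) * t)‖ + ‖cexp (-((ρ - 1 / 2) * t))‖) / 2 := by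
        gcongr; exact norm_add_le _ _
    _ ≤ (Real.exp (t / 2) + Real.exp (t / 2)) / 2 := by gcongr
    _ = Real.exp (t / 2) := by ring

/-- **Zero-side bound**: `‖Δ̂_t(ρ)‖ ≤ 2(e^{t/2} + 1)/‖ρ‖²` at every non-trivial zero. -/
theorem norm_weilMellin_tent_zero_le {t : ℝ} (ht : 0 ≤ t)
    (ρ : ZetaZeros.riemannZetaNontrivialZeros) :
    ‖weilMellin (tent t) ρ‖ ≤ 2 * (Real.exp (t / 2) + 1) / ‖(ρ : ℂ)‖ ^ 2 := by
  have h14 : 14 < |(ρ : ℂ).im| := FordL33.fourteen_lt_abs_im ⟨(ρ : ℂ), ρ.2⟩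
  have h14n : 14 < ‖(ρ : ℂ)‖ := FordL33.fourteen_lt_norm ⟨(ρ : ℂ), ρ.2⟩
  have hre0 : 0 < (ρ : ℂ).re := ZetaZeros.riemannZetaNontrivialZeros.re_pos ρ.2
  have hre1 : (ρ : ℂ).re < 1 := ZetaZeros.riemannZetaNontrivialZeros.re_lt_one ρ.2
  have hs : (ρ : ℂ) ≠ 1 / 2 := nontrivialZero_ne_half ρ
  rw [weilMellin_tent ht hs, norm_div, norm_pow]
  have hnum := norm_cosh_sub_one_le ht hre0 hre1
  have hi : |(ρ : ℂ).im| ≤ ‖(ρ : ℂ) - 1 / 2‖ := by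
    simpa using Complex.abs_im_le_norm ((ρ : ℂ) - 1 / 2)
  have hden : ‖(ρ : ℂ)‖ ^ 2 ≤ 2 * ‖(ρ : ℂ) - 1 / 2‖ ^ 2 := by
    have hn : ‖(ρ : ℂ)‖ ^ 2 = (ρ : ℂ).re ^ 2 + (ρ : ℂ).im ^ 2 := by
      rw [Complex.sq_norm, Complex.normSq_apply]; ring
    have hi2 : (ρ : ℂ).im ^ 2 ≤ ‖(ρ : ℂ) - 1 / 2‖ ^ 2 := by
      rw [← sq_abs]; exact pow_le_pow_left₀ (abs_nonneg _) hi 2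
    have h196 : 196 < (ρ : ℂ).im ^ 2 := by rw [← sq_abs]; nlinarith
    nlinarith
  have hD : 0 < ‖(ρ : ℂ) - 1 / 2‖ ^ 2 := by
    have : 0 < |(ρ : ℂ).im| := by linarith
    nlinarith [abs_nonneg ((ρ : ℂ).im)]
  have hN : 0 < ‖(ρ : ℂ)‖ ^ 2 := by positivity
  rw [div_le_div_iff₀ hD hN]
  calc ‖Complex.cosh (((ρ : ℂ) - 1 / 2) * t) - 1‖ * ‖(ρ : ℂ)‖ ^ 2
      ≤ (Real.exp (t / 2) + 1) * (2 * ‖(ρ : ℂ) - 1 / 2‖ ^ 2) :=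
        mul_le_mul hnum hden hN.le (by positivity)
    _ = 2 * (Real.exp (t / 2) + 1) * ‖(ρ : ℂ) - 1 / 2‖ ^ 2 := by ring

/-- **The zero side of the tent converges absolutely**: `∑_ρ ‖m(ρ) Δ̂_t(ρ)‖ < ∞`. -/
theorem summable_norm_tent_zeroSide {t : ℝ} (ht : 0 ≤ t) :
    Summable fun ρ : ZetaZeros.riemannZetaNontrivialZeros ↦
      ‖(riemannZetaZeroOrder (ρ : ℂ) : ℂ) * weilMellin (tent t) ρ‖ := by
  have hS : Summable fun ρ : ZetaZeros.riemannZetaNontrivialZeros ↦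
      (riemannZetaZeroOrder (ρ : ℂ) : ℝ) / ‖(ρ : ℂ)‖ ^ 2 := FordL33.summable_order_div_norm_sq
  refine (hS.mul_left (2 * (Real.exp (t / 2) + 1))).of_nonneg_of_le (fun _ ↦ norm_nonneg _)
    fun ρ ↦ ?_
  have hm : (0 : ℝ) < riemannZetaZeroOrder (ρ : ℂ) := FordL33.order_pos ⟨(ρ : ℂ), ρ.2⟩
  rw [norm_mul, Complex.norm_intCast, abs_of_pos hm]
  calc (riemannZetaZeroOrder (ρ : ℂ) : ℝ) * ‖weilMellin (tent t) ρ‖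
      ≤ (riemannZetaZeroOrder (ρ : ℂ) : ℝ) * (2 * (Real.exp (t / 2) + 1) / ‖(ρ : ℂ)‖ ^ 2) :=
        mul_le_mul_of_nonneg_left (norm_weilMellin_tent_zero_le ht ρ) hm.le
    _ = 2 * (Real.exp (t / 2) + 1) * ((riemannZetaZeroOrder (ρ : ℂ) : ℝ) / ‖(ρ : ℂ)‖ ^ 2) := by
        ring

/-! ## The archimedean integrand is integrable -/

/-- `(A + log(1+|u|))/(1+u²) ≤ 2(A+2)(1+|u|)^{-3/2}` for `A ≥ 0`. -/
theorem logWeight_le {A : ℝ} (hA : 0 ≤ A) (u : ℝ) :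
    (A + Real.log (1 + |u|)) / (1 + u ^ 2) ≤ 2 * (A + 2) * (1 + |u|) ^ (-(3 / 2 : ℝ)) := by
  set v : ℝ := 1 + |u| with hv
  have hv1 : 1 ≤ v := by rw [hv]; linarith [abs_nonneg u]
  have hv0 : 0 < v := by linarith
  set s : ℝ := Real.sqrt v with hs
  have hs1 : 1 ≤ s := Real.one_le_sqrt.2 hv1
  have hs0 : 0 < s := by linarith
  have hss : s * s = v := Real.mul_self_sqrt hv0.le
  have hlog : Real.log v ≤ 2 * s := by
    have h1 : Real.log s ≤ s - 1 := Real.log_le_sub_one_of_pos hs0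
    have h2 : Real.log v = 2 * Real.log s := by
      rw [← hss, Real.log_mul hs0.ne' hs0.ne']; ring
    linarith
  have hpow : v ^ (-(3 / 2 : ℝ)) = 1 / (v * s) := by
    rw [Real.rpow_neg hv0.le, show (3 / 2 : ℝ) = 1 + 1 / 2 by norm_num, Real.rpow_add hv0,
      Real.rpow_one, ← Real.sqrt_eq_rpow, one_div]
  rw [hpow]
  have hu2 : v ^ 2 ≤ 2 * (1 + u ^ 2) := by
    rw [hv]; nlinarith [abs_nonneg u, sq_abs u, sq_nonneg (|u| - 1)]
  rw [div_le_iff₀ (by positivity : (0 : ℝ) < 1 + u ^ 2)]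
  have key : A + Real.log v ≤ (A + 2) * s := by nlinarith
  have hvs : v / s = s := by rw [div_eq_iff hs0.ne', hss]
  calc A + Real.log v ≤ (A + 2) * s := key
    _ = (A + 2) * (v / s) := by rw [hvs]
    _ = 2 * (A + 2) * (1 / (v * s)) * (v ^ 2 / 2) := by field_simp
    _ ≤ 2 * (A + 2) * (1 / (v * s)) * (1 + u ^ 2) :=
        mul_le_mul_of_nonneg_left (by linarith) (by positivity)

/-- `u ↦ (A + log(1+|u|))/(1+u²)` is integrable (`A ≥ 0`). -/
theorem integrable_logWeight {A : ℝ} (hA : 0 ≤ A) :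
    Integrable fun u : ℝ ↦ (A + Real.log (1 + |u|)) / (1 + u ^ 2) := by
  have hI : Integrable fun u : ℝ ↦ (1 + ‖u‖) ^ (-(3 / 2 : ℝ)) :=
    integrable_one_add_norm (by rw [Module.finrank_self]; norm_num)
  refine (hI.const_mul (2 * (A + 2))).mono' ?_ (Eventually.of_forall fun u ↦ ?_)
  · have h1 : Continuous fun u : ℝ ↦ Real.log (1 + |u|) :=
      (by fun_prop : Continuous fun u : ℝ ↦ 1 + |u|).log fun u ↦ by positivity
    have h2 : Continuous fun u : ℝ ↦ A + Real.log (1 + |u|) := continuous_const.add h1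
    have h3 : Continuous fun u : ℝ ↦ (A + Real.log (1 + |u|)) / (1 + u ^ 2) :=
      h2.div (by fun_prop) fun u ↦ by positivity
    exact h3.aestronglyMeasurable
  · have h0 : 0 ≤ (A + Real.log (1 + |u|)) / (1 + u ^ 2) :=
      div_nonneg (add_nonneg hA (Real.log_nonneg (by linarith [abs_nonneg u]))) (by positivity)
    rw [Real.norm_of_nonneg h0, Real.norm_eq_abs]
    exact logWeight_le hA u

/-- **The archimedean integrand of the tent is integrable**:
`u ↦ Δ̂_t(½+iu) Re ψ(¼+iu/2)` is integrable. -/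
theorem integrable_weilMellin_tent_digamma {t : ℝ} (ht : 0 ≤ t) :
    Integrable fun u : ℝ ↦ weilMellin (tent t) (1 / 2 + u * I) *
      ((Complex.digamma (1 / 4 + u / 2 * I)).re : ℂ) := by
  obtain ⟨C, hC⟩ :=
    Literature.Analysis.SpecialFunctions.Complex.exists_norm_digamma_vertical_le (a := 1 / 4)
      (by norm_num)
  have hcont1 : Continuous fun u : ℝ ↦ weilMellin (tent t) (1 / 2 + u * I) :=
    (continuous_weilMellin (continuous_tent t) (hasCompactSupport_tent t)).comp (by fun_prop)
  have hcont2 : Continuous fun u : ℝ ↦ Complex.digamma (1 / 4 + u / 2 * I) := by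
    refine Literature.Analysis.SpecialFunctions.Complex.continuousOn_digamma.comp_continuous
      (by fun_prop) fun u ↦ ?_
    simp only [mem_setOf_eq, add_re, mul_re, I_re, I_im, mul_zero, mul_one]
    norm_num
  have hcont : Continuous fun u : ℝ ↦ weilMellin (tent t) (1 / 2 + u * I) *
      ((Complex.digamma (1 / 4 + u / 2 * I)).re : ℂ) :=
    hcont1.mul (Complex.continuous_ofReal.comp (Complex.continuous_re.comp hcont2))
  have hne : ∀ᵐ u : ℝ, u ≠ 0 := by simp [ae_iff]
  refine (((integrable_logWeight (abs_nonneg C)).const_mul (t ^ 2 + 4))).mono'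
    hcont.aestronglyMeasurable ?_
  filter_upwards [hne] with u hu
  have e : (1 / 4 : ℂ) + u / 2 * I = ((1 / 4 : ℝ) : ℂ) + ((u / 2 : ℝ) : ℂ) * I := by
    push_cast; ring
  have h1 := norm_weilMellin_tent_line_le ht hu
  have h2 : ‖(((Complex.digamma (1 / 4 + u / 2 * I)).re : ℝ) : ℂ)‖ ≤ |C| + Real.log (1 + |u|) := by
    rw [Complex.norm_real, Real.norm_eq_abs]
    refine (Complex.abs_re_le_norm _).trans ?_
    rw [e]
    refine (hC (u / 2)).trans ?_
    have : Real.log (1 + |u / 2|) ≤ Real.log (1 + |u|) := by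
      refine Real.log_le_log (by positivity) ?_
      rw [abs_div, abs_two]; linarith [abs_nonneg u]
    linarith [le_abs_self C]
  have h0 : 0 ≤ |C| + Real.log (1 + |u|) :=
    add_nonneg (abs_nonneg C) (Real.log_nonneg (by linarith [abs_nonneg u]))
  rw [norm_mul]
  calc ‖weilMellin (tent t) (1 / 2 + u * I)‖ *
        ‖(((Complex.digamma (1 / 4 + u / 2 * I)).re : ℝ) : ℂ)‖
      ≤ (t ^ 2 + 4) / (1 + u ^ 2) * (|C| + Real.log (1 + |u|)) :=
        mul_le_mul h1 h2 (norm_nonneg _) (by positivity)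
    _ = (t ^ 2 + 4) * ((|C| + Real.log (1 + |u|)) / (1 + u ^ 2)) := by ring

/-! ## Suzuki's series equals `W(Δ_t)` -/

/-- **The explicit formula for the tent** (T46): for `t ≥ 0`,
`∑_ρ m(ρ)(cosh((ρ−½)t) − 1)/(ρ−½)² = W(Δ_t)`, the sum over the non-trivial zeros converging
absolutely. -/
theorem hasSum_screw_weilFunctional_tent {t : ℝ} (ht : 0 ≤ t) :
    HasSum (fun ρ : ZetaZeros.riemannZetaNontrivialZeros ↦
      (riemannZetaZeroOrder (ρ : ℂ) : ℂ) *
        ((Complex.cosh (((ρ : ℂ) - 1 / 2) * t) - 1) / ((ρ : ℂ) - 1 / 2) ^ 2))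
      (weilFunctional (tent t)) := by
  have hZ := summable_norm_tent_zeroSide ht
  have hA := integrable_weilMellin_tent_digamma ht
  have h1 : HasWeilZeroSide (tent t) (weilFunctional (tent t)) :=
    explicit_formula_continuous (continuous_tent t) (hasCompactSupport_tent t) hZ hA
  have h2 := hasWeilZeroSide_tsum hZ
  have heq := tendsto_nhds_unique h2 h1
  have hfun : (fun ρ : ZetaZeros.riemannZetaNontrivialZeros ↦
      (riemannZetaZeroOrder (ρ : ℂ) : ℂ) *
        ((Complex.cosh (((ρ : ℂ) - 1 / 2) * t) - 1) / ((ρ : ℂ) - 1 / 2) ^ 2)) =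
      fun ρ : ZetaZeros.riemannZetaNontrivialZeros ↦
        (riemannZetaZeroOrder (ρ : ℂ) : ℂ) * weilMellin (tent t) ρ := by
    funext ρ
    rw [weilMellin_tent ht (nontrivialZero_ne_half ρ)]
  rw [hfun, ← heq]
  exact hZ.of_norm.hasSum

/-- `W(Δ_t) = 4(e^{t/2} + e^{−t/2} − 2) − zetaScrewPrimeSum t + weilArchTerm Δ_t`: the polar and
prime parts of Suzuki's (1.1) (`zetaScrew_eq`), with the archimedean term still to be computed. -/
theorem weilFunctional_tent {t : ℝ} (ht : 0 ≤ t) :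
    weilFunctional (tent t) =
      ((4 * (Real.exp (t / 2) + Real.exp (-(t / 2)) - 2) : ℝ) : ℂ) - (zetaScrewPrimeSum t : ℂ) +
        weilArchTerm (tent t) := by
  unfold weilFunctional
  rw [weilPolarTerm_tent ht, weilPrimeTerm_tent ht]

end Summit.RiemannHypothesis.RiemannHypothesis.Theorems

end
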